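import Summits.CriticalPhenomena.CardyFormulaZ2.Theorems.CardySelfRefinementLagHandOffNoTraceArms
import Literature.Probability.Percolation.FourArmGarbanShift
import Literature.Probability.Percolation.ZdOpenPathTrim
import Literature.Probability.Percolation.LatticeTraceGeometry
import Literature.Probability.Percolation.RSW
import HarnessLib

/-!
# No idling of the limit interface, part 2: three shell traversals by the bond-`ℤ²`
exploration polygon force Garban's four-arm event (lattice half)

Helper file for the registered stub `stub_limitCurveRegularity_noIdle` of line
`hitting-tournament` of crux `LagHandOff` (stmt-CriticalPhenomena-10268).  The dictionary
"`j` crossings of the exploration path give `j` alternating arms" (Smirnov–Werner, Math. Res.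
Lett. 8 (2001) §4 Rem. 6; Aizenman–Burchard, Duke Math. J. 99 (1999) App. A: "the crossing
segments cut the annulus into sectors") is needed in the CLUSTER FORM bounded by Garban's
multi-scale four-arm estimate (`fourArmTwoClusters`, `FourArmGarban.lean`: two open crossings of
a square annulus lying in distinct open clusters of the annulus).  This file proves the
lattice half of that dictionary, free of the exploration polygon:

* `openConnIn_of_chain` — a chain of sites with trivial or open steps inside `S` is an open
  connection inside `S`;
* `mem_connectedComponentIn_of_openConnIn` — if every open lattice edge between sites of `S` is
  drawn (through a point map `P`) inside a plane set `X`, then an open connection inside `S`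
  keeps the drawn endpoints in one connected component of `X`;
* `relabel_shift_subset_edgeSet` — lattice configurations stay lattice configurations under
  translation;
* `relabel_mem_fourArmTwoClusters_of_components` — **the separation principle**: two open
  connections inside `S` from the `m₁`-box around a centre `c` to outside the `(n₁-1)`-box, whose
  drawn starting points lie in DISTINCT components of `X`, put the configuration (recentred at
  `c`) in `fourArmTwoClusters m₁ n₁`: trim both to exact crossings of the square annulus
  (`exists_openConnIn_sqAnnulus_of_openConnIn`); an open junction of the two trimmed crossings
  inside the annulus, together with the trimming links, would be an open connection inside `S`
  between points drawn in distinct components.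

References: C. Garban, Appendix B of O. Schramm, S. Smirnov, Ann. Probab. 39 (2011), (B.2)
(the four-arm event at `z`); S. Smirnov, W. Werner, Math. Res. Lett. 8 (2001) §4 Rem. 6;
M. Aizenman, A. Burchard, Duke Math. J. 99 (1999), App. A.
-/

noncomputable section

open MeasureTheory Filter Set Topology Metric
open scoped unitInterval
open Literature.Probability.Percolation Literature.Probability.LatticeModels
open Literature.Probability.RandomPlanarGeometry

namespace Summit.CriticalPhenomena.CardyFormulaZ2.Cruxes.LagHandOff.HittingTournament

/-! ### Chains and open connections -/

section Lattice

variable {ω : BondConfig (Site 2)}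

/-- **A chain with trivial or open steps inside `S` is an open connection inside `S`.** -/
theorem openConnIn_of_chain {S : Set (Site 2)} (f : ℕ → Site 2) (m : ℕ)
    (hchain : ∀ j < m, f j = f (j + 1) ∨ s(f j, f (j + 1)) ∈ ω) (hS : ∀ j ≤ m, f j ∈ S) :
    ω ∈ openConnIn S (f 0) (f m) := by
  have hreach : ∀ j, ∀ hj : j ≤ m, ((openGraph ω).induce S).Reachable ⟨f 0, hS 0 (Nat.zero_le _)⟩
      ⟨f j, hS j hj⟩ := by
    intro j
    induction j with
    | zero => intro _; exact SimpleGraph.Reachable.refl _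
    | succ j ih =>
      intro hj
      have hj' : j ≤ m := Nat.le_of_succ_le hj
      refine (ih hj').trans ?_
      by_cases heq : f j = f (j + 1)
      · have : (⟨f j, hS j hj'⟩ : S) = ⟨f (j + 1), hS (j + 1) hj⟩ := Subtype.ext heq
        rw [this]
      · refine SimpleGraph.Adj.reachable ?_
        simp only [SimpleGraph.comap_adj, Function.Embedding.subtype_apply, openGraph_adj]
        rcases hchain j (by omega) with h | h
        · exact absurd h heq
        · exact ⟨h, heq⟩
  exact ⟨hS 0 (Nat.zero_le _), hS m le_rfl, hreach m le_rfl⟩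

/-- **Open connections keep drawn endpoints in one component.** If every open lattice edge
between two sites of `S` is drawn, through the point map `P`, as a segment inside the plane
set `X`, then for an open connection inside `S` from `u` to `v` (on a lattice configuration),
`P v` lies in the connected component of `P u` in `X`. -/
theorem mem_connectedComponentIn_of_openConnIn (hω : ω ⊆ (zdGraph 2).edgeSet) {X : Set ℂ}
    {S : Set (Site 2)} {P : Site 2 → ℂ}
    (hseg : ∀ u w, u ∈ S → w ∈ S → (zdGraph 2).Adj u w → s(u, w) ∈ ω →
      segment ℝ (P u) (P w) ⊆ X)
    {u v : Site 2} (h : ω ∈ openConnIn S u v) (hu : P u ∈ X) :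
    P v ∈ connectedComponentIn X (P u) := by
  obtain ⟨p, hps, hpe⟩ := exists_walk_of_mem_openConnIn hω h
  clear h
  induction p with
  | nil => exact mem_connectedComponentIn hu
  | @cons u' v' w' hadj p ih =>
    have hu'S : u' ∈ S := hps u' (SimpleGraph.Walk.start_mem_support _)
    have hv'S : v' ∈ S := hps v' (by simp)
    have he : s(u', v') ∈ ω := hpe _ (by simp)
    have hsub := hseg u' v' hu'S hv'S hadj he
    have h1 : P v' ∈ connectedComponentIn X (P u') :=
      (convex_segment _ _).isPreconnected.subset_connectedComponentIn (left_mem_segment _ _ _)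
        hsub (right_mem_segment _ _ _)
    have hv'X : P v' ∈ X := connectedComponentIn_subset _ _ h1
    have hps' : ∀ z ∈ p.support, z ∈ S := fun z hz =>
      hps z (by rw [SimpleGraph.Walk.support_cons]; exact List.mem_cons_of_mem _ hz)
    have hpe' : ∀ e ∈ p.edges, e ∈ ω := fun e he' =>
      hpe e (by rw [SimpleGraph.Walk.edges_cons]; exact List.mem_cons_of_mem _ he')
    have h2 : P w' ∈ connectedComponentIn X (P v') := ih hv'X hps' hpe'
    rw [connectedComponentIn_eq h1]
    exact h2

/-- **Translates of lattice configurations are lattice configurations.** -/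
theorem relabel_shift_subset_edgeSet (v : Site 2) (hω : ω ⊆ (zdGraph 2).edgeSet) :
    BondConfig.relabel (sym2Equiv (Site.shift v)) ω ⊆ (zdGraph 2).edgeSet := by
  intro e he
  induction e using Sym2.ind with
  | h a b =>
    have h1 : s(a - v + v, b - v + v) ∈ BondConfig.relabel (sym2Equiv (Site.shift v)) ω := by
      simpa only [sub_add_cancel] using he
    rw [mk_add_mem_relabel_shift_iff] at h1
    have hadj : (zdGraph 2).Adj (a - v) (b - v) := by
      have := hω h1
      rwa [SimpleGraph.mem_edgeSet] at this
    have := (zdGraph_adj_shift_iff v (a - v) (b - v)).2 hadj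
    simp only [Site.shift_apply, sub_add_cancel] at this
    exact (SimpleGraph.mem_edgeSet _).2 this

/-- Undoing the recentring. -/
theorem relabel_shift_relabel_shift_neg (c : Site 2) (ω : BondConfig (Site 2)) :
    BondConfig.relabel (sym2Equiv (Site.shift c))
      (BondConfig.relabel (sym2Equiv (Site.shift (-c))) ω) = ω := by
  have := relabel_shift_neg_relabel_shift (-c) ω
  rwa [neg_neg] at this

/-- **The separation principle behind the cluster form of the four-arm event.** On a lattice
configuration `ω`, let `S` be a set of sites such that every open lattice edge between sites of
`S` is drawn (through `P`) inside the plane set `X`, containing the recentred square annulus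
`c + A_{m₁,n₁}` (`1 ≤ m₁ ≤ n₁`). Suppose two open connections inside `S`, from sites of the box
`c + B(m₁)` to sites off `c + B(n₁ - 1)`, start at sites drawn in `X` in DISTINCT connected
components of `X`. Then `ω - c ∈ fourArmTwoClusters m₁ n₁`: trimming gives two exact open
crossings of `A_{m₁,n₁}` (for `ω - c`), and an open junction of their inner ends inside the
annulus would, with the trimming links, openly connect inside `S` two sites drawn in distinct
components (`mem_connectedComponentIn_of_openConnIn`).
[cite: SchrammSmirnov2011, Appendix B (Garban), (B.2)] -/
theorem relabel_mem_fourArmTwoClusters_of_components (hω : ω ⊆ (zdGraph 2).edgeSet)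
    {X : Set ℂ} {S : Set (Site 2)} {P : Site 2 → ℂ}
    (hseg : ∀ u w, u ∈ S → w ∈ S → (zdGraph 2).Adj u w → s(u, w) ∈ ω →
      segment ℝ (P u) (P w) ⊆ X)
    {c : Site 2} {m₁ n₁ : ℕ} (h1m : 1 ≤ m₁) (hmn : m₁ ≤ n₁)
    (hann : ∀ v, v - c ∈ sqAnnulus m₁ n₁ → v ∈ S)
    {vin vout : Fin 2 → Site 2} (hconn : ∀ q, ω ∈ openConnIn S (vin q) (vout q))
    (hin : ∀ q, vin q - c ∈ box 2 m₁) (hout : ∀ q, vout q - c ∉ box 2 (n₁ - 1))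
    (hX : ∀ q, P (vin q) ∈ X)
    (hne : connectedComponentIn X (P (vin 0)) ≠ connectedComponentIn X (P (vin 1))) :
    BondConfig.relabel (sym2Equiv (Site.shift (-c))) ω ∈ fourArmTwoClusters m₁ n₁ := by
  set φ := Site.shift (-c) with hφ
  set ω' := BondConfig.relabel (sym2Equiv φ) ω with hω'
  have hω'E : ω' ⊆ (zdGraph 2).edgeSet := relabel_shift_subset_edgeSet (-c) hω
  have hφapp : ∀ v : Site 2, φ v = v - c := fun v => by
    rw [hφ, Site.shift_apply, sub_eq_add_neg]
  -- trim the two recentred connections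
  have htrim : ∀ q, ∃ x' ∈ siteSphere m₁, ∃ y' ∈ siteSphere n₁,
      ω' ∈ openConnIn (sqAnnulus m₁ n₁) x' y' ∧ ω' ∈ openConnIn (φ '' S) (φ (vin q)) x' := by
    intro q
    have h1 : ω' ∈ openConnIn (φ '' S) (φ (vin q)) (φ (vout q)) :=
      relabel_mem_openConnIn φ (hconn q)
    have hin' : φ (vin q) ∈ box 2 m₁ := by rw [hφapp]; exact hin q
    have hout' : φ (vout q) ∉ box 2 (n₁ - 1) := by rw [hφapp]; exact hout q
    exact exists_openConnIn_sqAnnulus_of_openConnIn hω'E h1 h1m hmn hin' hout'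
  choose x' hx' y' hy' hcross hlink using htrim
  refine ⟨x' 0, hx' 0, x' 1, hx' 1, y' 0, hy' 0, y' 1, hy' 1, hcross 0, hcross 1, fun hjoin => ?_⟩
  -- transport back to `ω`
  have hback : BondConfig.relabel (sym2Equiv (Site.shift c)) ω' = ω :=
    relabel_shift_relabel_shift_neg c ω
  have himgS : Site.shift c '' (φ '' S) = S := by
    rw [Set.image_image]
    have : (fun x => Site.shift c (φ x)) = id := funext fun x => by
      rw [Site.shift_apply, hφapp, sub_add_cancel]; rfl
    rw [this, Set.image_id]
  have hshift_vin : ∀ q, Site.shift c (φ (vin q)) = vin q := fun q => by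
    rw [Site.shift_apply, hφapp, sub_add_cancel]
  have hlink' : ∀ q, ω ∈ openConnIn S (vin q) (x' q + c) := by
    intro q
    have := relabel_mem_openConnIn (Site.shift c) (hlink q)
    rwa [hback, himgS, hshift_vin, Site.shift_apply] at this
  have hjoin' : ω ∈ openConnIn S (x' 0 + c) (x' 1 + c) := by
    have h1 := relabel_mem_openConnIn (Site.shift c) hjoin
    rw [hback, Site.shift_apply, Site.shift_apply] at h1
    refine openConnIn_mono (fun v hv => ?_) _ _ h1
    obtain ⟨w, hw, rfl⟩ := hv
    refine hann _ ?_
    rw [Site.shift_apply, add_sub_cancel_right]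
    exact hw
  -- components
  have e0 : P (x' 0 + c) ∈ connectedComponentIn X (P (vin 0)) :=
    mem_connectedComponentIn_of_openConnIn hω hseg (hlink' 0) (hX 0)
  have e1 : P (x' 1 + c) ∈ connectedComponentIn X (P (vin 1)) :=
    mem_connectedComponentIn_of_openConnIn hω hseg (hlink' 1) (hX 1)
  have e01 : P (x' 1 + c) ∈ connectedComponentIn X (P (x' 0 + c)) :=
    mem_connectedComponentIn_of_openConnIn hω hseg hjoin' (connectedComponentIn_subset _ _ e0)
  apply hne
  rw [connectedComponentIn_eq e0, connectedComponentIn_eq e01, connectedComponentIn_eq e1]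

/-- **Box membership from a mesh distance.** -/
theorem sub_mem_box_of_dist_le {δ : ℝ} (hδ : 0 < δ) {k : ℕ} {v c : Site 2}
    (h : dist (meshPoint δ v) (meshPoint δ c) ≤ k * δ) : v - c ∈ box 2 k := by
  rw [mem_box]
  rw [Complex.dist_eq] at h
  have hre := (Complex.abs_re_le_norm (meshPoint δ v - meshPoint δ c)).trans h
  have him := (Complex.abs_im_le_norm (meshPoint δ v - meshPoint δ c)).trans h
  rw [Complex.sub_re, meshPoint_re, meshPoint_re, ← mul_sub, abs_mul, abs_of_pos hδ] at hre
  rw [Complex.sub_im, meshPoint_im, meshPoint_im, ← mul_sub, abs_mul, abs_of_pos hδ] at him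
  have hre' : |((v 0 : ℤ) : ℝ) - ((c 0 : ℤ) : ℝ)| ≤ k :=
    le_of_mul_le_mul_left (hre.trans_eq (mul_comm _ _)) hδ
  have him' : |((v 1 : ℤ) : ℝ) - ((c 1 : ℤ) : ℝ)| ≤ k :=
    le_of_mul_le_mul_left (him.trans_eq (mul_comm _ _)) hδ
  rw [abs_le] at hre' him'
  intro i
  fin_cases i
  · simp only [Fin.zero_eta, Pi.sub_apply]
    exact ⟨by exact_mod_cast hre'.1, by exact_mod_cast hre'.2⟩
  · simp only [Fin.mk_one, Pi.sub_apply]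
    exact ⟨by exact_mod_cast him'.1, by exact_mod_cast him'.2⟩

/-- **A mesh distance from box membership.** -/
theorem dist_le_of_sub_mem_box {δ : ℝ} (hδ : 0 ≤ δ) {k : ℕ} {v c : Site 2}
    (h : v - c ∈ box 2 k) : dist (meshPoint δ v) (meshPoint δ c) ≤ 2 * k * δ := by
  rw [mem_box] at h
  have h0 := h 0
  have h1 := h 1
  simp only [Pi.sub_apply] at h0 h1
  rw [Complex.dist_eq]
  refine (Complex.norm_le_abs_re_add_abs_im _).trans ?_
  rw [Complex.sub_re, meshPoint_re, meshPoint_re, ← mul_sub, abs_mul, abs_of_nonneg hδ,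
    Complex.sub_im, meshPoint_im, meshPoint_im, ← mul_sub, abs_mul, abs_of_nonneg hδ]
  have h0' : |((v 0 : ℤ) : ℝ) - ((c 0 : ℤ) : ℝ)| ≤ k :=
    abs_le.2 ⟨by exact_mod_cast h0.1, by exact_mod_cast h0.2⟩
  have h1' : |((v 1 : ℤ) : ℝ) - ((c 1 : ℤ) : ℝ)| ≤ k :=
    abs_le.2 ⟨by exact_mod_cast h1.1, by exact_mod_cast h1.2⟩
  nlinarith [abs_nonneg (((v 0 : ℤ) : ℝ) - ((c 0 : ℤ) : ℝ)),
    abs_nonneg (((v 1 : ℤ) : ℝ) - ((c 1 : ℤ) : ℝ))]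

/-- **A lower mesh distance from square-annulus membership** (`1 ≤ m`). -/
theorem le_dist_of_sub_mem_sqAnnulus {δ : ℝ} (hδ : 0 ≤ δ) {m n : ℕ} (hm : 1 ≤ m) {v c : Site 2}
    (h : v - c ∈ sqAnnulus m n) : (m : ℝ) * δ ≤ dist (meshPoint δ v) (meshPoint δ c) := by
  rw [mem_sqAnnulus_iff hm] at h
  obtain ⟨-, i, hi⟩ := h
  rw [Complex.dist_eq]
  have key : ∀ j : Fin 2, (m : ℤ) ≤ (v - c) j ∨ (v - c) j ≤ -(m : ℤ) →
      (m : ℝ) * δ ≤ δ * |((v j : ℤ) : ℝ) - ((c j : ℤ) : ℝ)| := by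
    intro j hj
    simp only [Pi.sub_apply] at hj
    have : (m : ℝ) ≤ |((v j : ℤ) : ℝ) - ((c j : ℤ) : ℝ)| := by
      rcases hj with hj | hj
      · have : ((m : ℤ) : ℝ) ≤ ((v j : ℤ) : ℝ) - ((c j : ℤ) : ℝ) := by exact_mod_cast hj
        push_cast at this
        exact this.trans (le_abs_self _)
      · have : ((v j : ℤ) : ℝ) - ((c j : ℤ) : ℝ) ≤ -((m : ℤ) : ℝ) := by exact_mod_cast hj
        push_cast at this
        have := neg_abs_le (((v j : ℤ) : ℝ) - ((c j : ℤ) : ℝ))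
        linarith
    nlinarith
  have := key i hi
  fin_cases i
  · refine this.trans ?_
    have h1 := Complex.abs_re_le_norm (meshPoint δ v - meshPoint δ c)
    rw [Complex.sub_re, meshPoint_re, meshPoint_re, ← mul_sub, abs_mul, abs_of_nonneg hδ] at h1
    exact h1
  · refine this.trans ?_
    have h1 := Complex.abs_im_le_norm (meshPoint δ v - meshPoint δ c)
    rw [Complex.sub_im, meshPoint_im, meshPoint_im, ← mul_sub, abs_mul, abs_of_nonneg hδ] at h1
    exact h1

/-- **A short segment anchored in a round shell stays in a slightly larger shell.** -/
theorem segment_subset_annulus {x a b : ℂ} {lo hi L r₁ r₂ : ℝ} (ha1 : lo ≤ dist a x)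
    (ha2 : dist a x ≤ hi) (hab : dist a b ≤ L) (h1 : r₁ < lo - L) (h2 : hi + L < r₂) :
    segment ℝ a b ⊆ ball x r₂ \ closedBall x r₁ := by
  intro z hz
  have hz' : dist a z ≤ dist a b := by
    have := dist_add_dist_of_mem_segment hz
    linarith [dist_nonneg (x := z) (y := b)]
  constructor
  · rw [mem_ball]
    linarith [dist_triangle z a x, dist_comm z a]
  · rw [mem_closedBall, not_le]
    linarith [dist_triangle a z x]


/-- **Registered sub-stub `stub_noIdle_separation`** (line `hitting-tournament`, stub
`stub_limitCurveRegularity_noIdle`, helper 2): the separation principle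
`relabel_mem_fourArmTwoClusters_of_components` with all arguments explicit.
[cite: SchrammSmirnov2011, Appendix B (Garban), (B.2)] -/
theorem stub_noIdle_separation : ∀ (ω : BondConfig (Site 2)), ω ⊆ (zdGraph 2).edgeSet → ∀ (X : Set ℂ) (S : Set (Site 2)) (P : Site 2 → ℂ), (∀ u w, u ∈ S → w ∈ S → (zdGraph 2).Adj u w → s(u, w) ∈ ω → segment ℝ (P u) (P w) ⊆ X) → ∀ (c : Site 2) (m₁ n₁ : ℕ), 1 ≤ m₁ → m₁ ≤ n₁ → (∀ v, v - c ∈ sqAnnulus m₁ n₁ → v ∈ S) → ∀ (vin vout : Fin 2 → Site 2), (∀ q, ω ∈ openConnIn S (vin q) (vout q)) → (∀ q, vin q - c ∈ box 2 m₁) → (∀ q, vout q - c ∉ box 2 (n₁ - 1)) → (∀ q, P (vin q) ∈ X) → connectedComponentIn X (P (vin 0)) ≠ connectedComponentIn X (P (vin 1)) → BondConfig.relabel (sym2Equiv (Site.shift (-c))) ω ∈ fourArmTwoClusters m₁ n₁ :=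
  fun _ hω _ _ _ hseg _ _ _ h1m hmn hann _ _ hconn hin hout hX hne =>
    relabel_mem_fourArmTwoClusters_of_components hω hseg h1m hmn hann hconn hin hout hX hne

end Lattice

/-! ### Open and dual-open lattice edges in the bulk are free of the perturbed polygon -/

section Free

open Literature.Probability.LatticeModels.IsMedialExploration

variable {D' : DiscreteDobrushin} {ω : BondConfig (Site 2)} {a : MedialVertex}
  {l : List MedialVertex}

/-- **An `ω`-open lattice edge with no end on the dual-wired arc is not met by the perturbed
exploration polygon**: the polygon meets a lattice edge only if the path crosses it, and a
crossed edge is an edge of `Ω_δ` closed in the completed configuration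
(`edge_of_mem_edgeTrace`), which an `ω`-open edge off the arc `B` is not.
[cite: Smirnov2001, §2] -/
theorem segment_meshPoint_disjoint_pertTrace (hexp : IsMedialExploration D' ω (a :: l))
    (hδ : 0 < D'.δ) {u w : Site 2} (hadj : (zdGraph 2).Adj u w) (hω : s(u, w) ∈ ω)
    (hu : u ∉ D'.zdArcB) (hw : w ∉ D'.zdArcB) :
    ∀ z ∈ segment ℝ (meshPoint D'.δ u) (meshPoint D'.δ w), z ∉ hexp.pertTrace := by
  intro z hz hzt
  rw [meshPoint_eq_smul, meshPoint_eq_smul, mem_segment_smul_iff hδ.ne'] at hz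
  obtain ⟨i, hi, -, hsrc, hbc⟩ := hexp.edge_of_mem_edgeTrace hδ hadj hzt hz
  apply hbc
  rw [DiscreteDobrushin.mem_bcBondConfig_iff]
  refine ⟨(SimpleGraph.mem_edgeSet _).2 (adj_of_eq_cornerSource hexp hi.2 hsrc), Or.inr ⟨hω, ?_⟩⟩
  intro y hy
  rcases Sym2.mem_iff.1 hy with rfl | rfl
  · exact hu
  · exact hw

/-- **A dual-open dual edge between two faces off the wired arc is not met by the perturbed
exploration polygon**: the polygon meets the centre segment of two adjacent faces only along a
followed edge, which is open in the completed configuration (`exists_mem_bc_of_mem_centerSeg`),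
i.e. `ω`-open (impossible for the primal edge of a dual-open dual edge) or with both ends on
the wired arc `A` — but one of its ends is (the index site of) one of the two faces.
[cite: Smirnov2001, §2] -/
theorem segment_faceCenter_disjoint_pertTrace (hexp : IsMedialExploration D' ω (a :: l))
    (hδ : 0 < D'.δ) {f g : Site 2} (hadj : (zdGraph 2).Adj f g) (hd : s(f, g) ∈ dualConfig ω)
    (hf : f ∉ D'.zdArcA) (hg : g ∉ D'.zdArcA) :
    ∀ z ∈ segment ℝ (D'.δ • faceCenter f) (D'.δ • faceCenter g), z ∉ hexp.pertTrace := by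
  intro z hz hzt
  rw [mem_segment_smul_iff hδ.ne'] at hz
  obtain ⟨e, hebc, hde⟩ := hexp.exists_mem_bc_of_mem_centerSeg hδ hadj hzt hz
  rw [mem_dualConfig_iff] at hd
  rcases (D'.mem_bcBondConfig_iff).1 hebc with ⟨heE, hAA | ⟨heω, -⟩⟩
  · -- both ends of `e` lie on `A`; one of them is `f` or `g`
    have heE' : e ∈ (zdGraph 2).edgeSet := by
      revert heE
      induction e using Sym2.ind with
      | h p q =>
        intro heE
        exact (SimpleGraph.mem_edgeSet _).2 (meshGraph_le_zdGraph _ _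
          (discreteDomainGraph_le_meshGraph _ _ ((SimpleGraph.mem_edgeSet _).1 heE)))
    obtain ⟨p, i, rfl⟩ := mem_edgeSet_zdGraph_iff.1 heE'
    have hpA : p ∈ D'.zdArcA := hAA p (Sym2.mem_mk_left _ _)
    have hpfg : p = f ∨ p = g := by
      fin_cases i
      · simp only [Fin.zero_eta] at hde
        rw [dualEdge_horizontal, Sym2.eq_iff] at hde
        rcases hde with ⟨-, h⟩ | ⟨-, h⟩
        · exact Or.inr h
        · exact Or.inl h
      · simp only [Fin.mk_one] at hde
        rw [dualEdge_vertical, Sym2.eq_iff] at hde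
        rcases hde with ⟨-, h⟩ | ⟨-, h⟩
        · exact Or.inr h
        · exact Or.inl h
    rcases hpfg with rfl | rfl
    · exact hf hpA
    · exact hg hpA
  · exact hd.2 e heω hde

/-- The centre of a face is within `δ` of its index corner, at mesh `δ`. [folklore] -/
theorem dist_smul_faceCenter_meshPoint_le {δ : ℝ} (hδ : 0 < δ) (f : Site 2) :
    dist (δ • faceCenter f) (meshPoint δ f) ≤ δ := by
  rw [meshPoint_eq_smul, dist_smul₀, Real.norm_eq_abs, abs_of_pos hδ]
  nlinarith [dist_faceCenter_toComplex_le (isCorner_self f)]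

end Free

end Summit.CriticalPhenomena.CardyFormulaZ2.Cruxes.LagHandOff.HittingTournament

end
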